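import Mathlib
import Literature.Computability.Complexity.RangeAvoidance
import Literature.Computability.Complexity.SignDegreeXor
import Summits.PneNP.PneNP.Theorems.PstarTyped
import Summits.PneNP.PneNP.Theorems.PstarPairwise

/-!
# Level-2 (Sherali–Adams + moment-matrix) blindness on typed `P⋆` instances
(cell `pnp-ideate`, ROUND-20 §3: the degree-2 ceiling N6 as a restricted-model theorem)

FRONTIER range-avoidance ladder, rung F-N3 (`P⋆ = x_a ⊕ x_b ⊕ x_c·x_d` at linear stretch) — a restricted-model
NO-GO; nothing here bears on `P` vs `NP`.

`SA2Feasible I y` is level-2 feasibility of the system `I(x) = y` in the mixed Sherali–Adams / Lasserre sense: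
global singleton pseudo-marginals `p_v` and pair pseudo-marginals `P_{uv}` whose `2 × 2` tables are probability
distributions (Fréchet inequalities) and whose moment matrix `[1 pᵀ; p P]` (diagonal `p`) is positive semidefinite,
together with one genuine local distribution `μ_j` per output on its slot patterns `{0,1}⁴`, supported on the fibre
`table_j⁻¹(y_j)` and with 1- and 2-marginals equal to `p`, `P` at the output's variables.  An AVOID algorithm whose
certificate for `y ∉ Range(I)` is a level-2 refutation — a nonnegative combination of valid local inequalities
(such as the flip inequalities K1 / A of `PstarIsolation*`) and quadratic forms with a PSD certificate (such as
the expander-mixing bounds in `PstarIsolationBound.isolationTheorem`) — can only succeed where `SA2Feasible I y`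
FAILS.

* `sa2Feasible_of_typed`: on every TYPED pure-`P⋆` instance (XOR-read and AND-read variables disjoint,
  `PstarTyped.Typed`) and for EVERY target `y`, `SA2Feasible I y` holds: biases `½` on XOR-occurring variables and
  `1/√2` on all others, PRODUCT pair marginals (so the moment matrix is that of a product measure,
  `posSemidef_momentMatrix_product`), and the pairwise-independent local laws `PstarPairwise.lp (√2/2) (y j)`.
  Typedness is exactly what makes the two biases globally consistent.
* `exists_not_mem_range_and_sa2Feasible`: hence for `n < m` there are non-range points that level 2 cannot
  refute — level-2 methods are blind on the whole typed class (which contains the hard candidate H-typed and, by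
  the doubling `PstarTyped.typedDouble`, decides the roof `PstarAvoidLinearFP` at half the stretch).
Contrast: on untyped BALANCED instances the common bias is forced to `1` (`PstarPairwise.bias_eq_one_of_tied`),
the level-2 point at the all-ones context is the planted point itself, and the level-2 isolation theorem M19
exists.  [posed and proved in the cell, ROUND-20 seed §3]
-/

set_option linter.dupNamespace false

open Literature.Computability.Complexity Matrix
open Summit.PneNP.PneNP.Theorems.PstarPairwise

namespace Summit.PneNP.PneNP.Theorems.PstarSA2Blind

variable {n m : ℕ}

/-- The level-2 moment matrix of singleton pseudo-marginals `p` and pair pseudo-marginals `P`, indexed by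
`Option (Fin n)` (`none` = the constant `1`): entries `1`, `p_v`, `p_v` (diagonal, `x_v² = x_v`), `P_{uv}`. -/
noncomputable def momentMatrix (p : Fin n → ℝ) (P : Fin n → Fin n → ℝ) : Matrix (Option (Fin n)) (Option (Fin n)) ℝ :=
  fun a b => match a, b with
    | none, none => 1
    | none, some v => p v
    | some u, none => p u
    | some u, some v => if u = v then p u else P u v

/-- **Level-2 feasibility of `I(x) = y`** (Sherali–Adams level 2 with the PSD moment-matrix constraint): global
singleton / pair pseudo-marginals with Fréchet-consistent `2 × 2` tables and PSD moment matrix, and per-output local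
distributions on slot patterns supported on the fibre of `y_j`, with matching 1- and 2-marginals. -/
def SA2Feasible (I : LocalMap 4 n m) (y : Fin m → Bool) : Prop :=
  ∃ (p : Fin n → ℝ) (P : Fin n → Fin n → ℝ) (μ : Fin m → (Fin 4 → Bool) → ℝ),
    (∀ v, 0 ≤ p v ∧ p v ≤ 1) ∧
    (∀ u v, P u v = P v u) ∧
    (∀ u v, u ≠ v → 0 ≤ P u v ∧ p u + p v - 1 ≤ P u v ∧ P u v ≤ p u ∧ P u v ≤ p v) ∧
    (momentMatrix p P).PosSemidef ∧
    (∀ j w, 0 ≤ μ j w) ∧ (∀ j, ∑ w, μ j w = 1) ∧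
    (∀ j w, μ j w ≠ 0 → I.table j w = y j) ∧
    (∀ j (s : Fin 4), pr1 (μ j) s true = p (I.vars j s)) ∧
    (∀ j (s s' : Fin 4), s ≠ s' → pr2 (μ j) s s' true true = P (I.vars j s) (I.vars j s'))

/-! ### The product moment matrix is PSD -/

/-- A rank-one matrix `a aᵀ` is positive semidefinite. [folklore] -/
theorem posSemidef_vecMulVec_self {ι : Type*} [Fintype ι] [DecidableEq ι] (a : ι → ℝ) :
    (vecMulVec a a).PosSemidef := by
  refine PosSemidef.of_dotProduct_mulVec_nonneg ?_ fun x => ?_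
  · ext i j
    simp [vecMulVec_apply, mul_comm]
  · have h : star x ⬝ᵥ (vecMulVec a a *ᵥ x) = (∑ i, a i * x i) * ∑ j, a j * x j := by
      rw [Finset.sum_mul_sum]
      simp only [dotProduct, mulVec, vecMulVec_apply, star_trivial, Finset.mul_sum]
      exact Finset.sum_congr rfl fun i _ => Finset.sum_congr rfl fun j _ => by ring
    rw [h]
    exact mul_self_nonneg _

/-- The moment matrix of PRODUCT pair marginals `P_{uv} = p_u p_v` is `a aᵀ + diag(0, p - p²)` with `a = (1, p)`. -/
theorem momentMatrix_product_eq (p : Fin n → ℝ) :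
    momentMatrix p (fun u v => p u * p v) =
      vecMulVec (fun a => Option.elim a 1 p) (fun a => Option.elim a 1 p) +
        diagonal (fun a => Option.elim a 0 (fun v => p v - p v ^ 2)) := by
  ext a b
  rcases a with _ | u <;> rcases b with _ | v
  · simp [momentMatrix, vecMulVec_apply, diagonal]
  · simp [momentMatrix, vecMulVec_apply, diagonal]
  · simp [momentMatrix, vecMulVec_apply, diagonal]
  · by_cases h : u = v
    · subst h
      simp [momentMatrix, vecMulVec_apply, diagonal]
      ring
    · simp [momentMatrix, vecMulVec_apply, diagonal, h]

/-- **The product moment matrix is PSD** whenever `0 ≤ p ≤ 1` (it is the moment matrix of the product measure). -/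
theorem posSemidef_momentMatrix_product (p : Fin n → ℝ) (hp : ∀ v, 0 ≤ p v ∧ p v ≤ 1) :
    (momentMatrix p (fun u v => p u * p v)).PosSemidef := by
  rw [momentMatrix_product_eq]
  refine (posSemidef_vecMulVec_self _).add (PosSemidef.diagonal fun a => ?_)
  rcases a with _ | v
  · simp
  · have := hp v
    simp only [Option.elim, Pi.zero_apply]
    nlinarith [mul_nonneg this.1 (sub_nonneg.2 this.2)]

/-! ### Typed instances are level-2 feasible for every target -/

/-- A variable is XOR-occurring if some output reads it in an XOR slot (`0` or `1`). -/
def IsXorVar (I : LocalMap 4 n m) (v : Fin n) : Prop := ∃ j : Fin m, ∃ s : Fin 4, s.val < 2 ∧ I.vars j s = v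

/-- On a typed instance an AND slot never reads an XOR-occurring variable. -/
theorem not_isXorVar_of_typed (I : LocalMap 4 n m) (hT : PstarTyped.Typed I) (j : Fin m) (s' : Fin 4)
    (hs' : 2 ≤ s'.val) : ¬ IsXorVar I (I.vars j s') := by
  rintro ⟨j', s, hs, h⟩
  exact hT j' j s s' hs hs' h

/-- There is a point outside the range as soon as `n < m` (counting). [folklore] -/
theorem exists_not_mem_range {k : ℕ} (I : LocalMap k n m) (h : n < m) : ∃ y, y ∉ I.range := by
  have hns : ¬ Function.Surjective I.eval := fun hs => by
    have hc := Fintype.card_le_of_surjective _ hs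
    simp only [Fintype.card_fun, Fintype.card_bool, Fintype.card_fin] at hc
    exact absurd hc (not_le.2 (Nat.pow_lt_pow_right (by norm_num) h))
  obtain ⟨y, hy⟩ := not_forall.1 hns
  exact ⟨y, hy⟩

/-- **Level-2 blindness on typed instances.**  Every typed pure-`P⋆` instance is level-2 feasible for every target
`y`: biases `½` on XOR-occurring variables, `√2/2` elsewhere, product pair marginals, local laws `lp (√2/2) (y j)`. -/
theorem sa2Feasible_of_typed (I : LocalMap 4 n m) (hI : I.IsPure xorAndPred) (hT : PstarTyped.Typed I)
    (y : Fin m → Bool) : SA2Feasible I y := by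
  classical
  obtain ⟨hr, h0, h1⟩ := lp_hyp_sqrt
  set r : ℝ := Real.sqrt 2 / 2
  let p : Fin n → ℝ := fun v => if IsXorVar I v then 1 / 2 else r
  have hp : ∀ v, 0 ≤ p v ∧ p v ≤ 1 := fun v => by
    simp only [p]
    split_ifs
    · norm_num
    · exact ⟨h0, h1⟩
  -- the one-slot marginals of the local laws are the global biases (this is where typedness enters)
  have e0 : ∀ j, pr1 (lp r (y j)) 0 true = p (I.vars j 0) := fun j => by
    have hx : IsXorVar I (I.vars j 0) := ⟨j, 0, by decide, rfl⟩
    simp only [p, if_pos hx]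
    exact pr1_lp_zero r (y j)
  have e1 : ∀ j, pr1 (lp r (y j)) 1 true = p (I.vars j 1) := fun j => by
    have hx : IsXorVar I (I.vars j 1) := ⟨j, 1, by decide, rfl⟩
    simp only [p, if_pos hx]
    exact pr1_lp_one r (y j)
  have e2 : ∀ j, pr1 (lp r (y j)) 2 true = p (I.vars j 2) := fun j => by
    have hx : ¬ IsXorVar I (I.vars j 2) := not_isXorVar_of_typed I hT j 2 (by decide)
    simp only [p, if_neg hx]
    exact pr1_lp_two r (y j)
  have e3 : ∀ j, pr1 (lp r (y j)) 3 true = p (I.vars j 3) := fun j => by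
    have hx : ¬ IsXorVar I (I.vars j 3) := not_isXorVar_of_typed I hT j 3 (by decide)
    simp only [p, if_neg hx]
    exact pr1_lp_three r (y j)
  have hpr1 : ∀ j (s : Fin 4), pr1 (lp r (y j)) s true = p (I.vars j s) := by
    intro j s
    fin_cases s
    exacts [e0 j, e1 j, e2 j, e3 j]
  refine ⟨p, fun u v => p u * p v, fun j => lp r (y j), hp, fun u v => mul_comm _ _, fun u v _ => ?_,
    posSemidef_momentMatrix_product p hp, fun j w => lp_nonneg h0 h1 (y j) w, fun j => lp_total r (y j),
    fun j w hw => ?_, hpr1, fun j s s' hss' => ?_⟩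
  · have hu := hp u
    have hv := hp v
    refine ⟨mul_nonneg hu.1 hv.1, ?_, ?_, ?_⟩
    · nlinarith [hu.1, hu.2, hv.1, hv.2]
    · nlinarith [hu.1, hu.2, hv.1, hv.2]
    · nlinarith [hu.1, hu.2, hv.1, hv.2]
  · rw [hI.1 j]
    exact lp_support r (y j) w hw
  · rw [pairwiseIndep_lp hr (y j) s s' hss' true true, hpr1 j s, hpr1 j s']

/-- **Hence level 2 cannot solve typed AVOID**: whenever `n < m`, some non-range point is level-2 feasible. -/
theorem exists_not_mem_range_and_sa2Feasible (I : LocalMap 4 n m) (hI : I.IsPure xorAndPred)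
    (hT : PstarTyped.Typed I) (hnm : n < m) : ∃ y, y ∉ I.range ∧ SA2Feasible I y := by
  obtain ⟨y, hy⟩ := exists_not_mem_range I hnm
  exact ⟨y, hy, sa2Feasible_of_typed I hI hT y⟩

end Summit.PneNP.PneNP.Theorems.PstarSA2Blind
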